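import Summits.BirchSwinnertonDyer.BirchSwinnertonDyer.Theorems.ManinLocalTwoThreeDegeneracyUnitTwistSignMove
import Summits.BirchSwinnertonDyer.Rank1Residual.ManinAdditive.DegeneracyClassUnitTwist
import HarnessLib

/-!
# E-es-91 ⟸ E-es-68₉ (hence E-es-91 ⟺ E-es-68₉): at `3 ∣ N` every ratio-`t` degeneracy loop IS a prime-class loop
# (`m ≡ 2 (mod 3)`) — Lemma G's sign move holds for EVERY cusp form, without complex conjugation

Summit `BirchSwinnertonDyer`, route `ManinLocalTwoThree` (cell bsd-f2-manin), crux C3 `ManinPrimeToThreeAtNine`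
(stmt-BirchSwinnertonDyer-22968).  The cell has two typed ratio-`9` lattice laws: E-es-68₉ `DegeneracyLoopLawNine` (all prime
denominators) and es g22's prime-class form E-es-91 `DegeneracyClassLoopLawNine` (denominators `m ≡ 2 (mod 3)`), with the typer's
PROVED edge E-es-91 ⟹ E-es-68₉ (`degeneracyLoopLawNine_of_classLawNine`, «(K₉)♮ is formally the STRONGER row»).  This file
proves the converse, so the two rows are EQUIVALENT and every theorem over es's class hypothesis
(`…ManinAdditive.DegeneracyClassUnitTwist`, `…DegeneracyClassEulerUnitTwist`) also runs from the plain hypothesis: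

* `modularSymbol_div_eq_neg_div_of_neg_add` — for ANY `f ∈ S₂(Γ₀(N))` (no real coefficients): `ℓ = −ℓ' + NKc` ⟹
  `{∞, c/ℓ}_f = {∞, (−c)/ℓ'}_f` (the lower unipotent `(1 0; NK 1)` has zero period, `modularSymbol_div_lowerUnipotent`);
* `degeneracyLoops_subset_degeneracyLoopsClassTwo` — at `3 ∣ N`, `t ≥ 1`: `degeneracyLoops f t ⊆ degeneracyLoopsClassTwo f t`
  (a loop at a prime `ℓ ≡ 1 (mod 3)` EQUALS the loop at `(ℓ', ℓ' − b mod ℓ')` for any prime `ℓ' ≡ −ℓ (mod tNb)`, Dirichlet);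
  `closure_degeneracyLoops_eq_closure_degeneracyLoopsClassTwo`;
* `degeneracyClassLoopLawNine_of_lawNine : DegeneracyLoopLawNine → DegeneracyClassLoopLawNine`, `degeneracyClassLoopLawNine_iff`;
* `degeneracyClassPlusIndexPrimeTo_of_degeneracyPlusIndexPrimeTo` — the class plus-index hypothesis of THEOREM U♮ from the plain
  one (`KatoCurve.DegeneracyPlusIndexPrimeTo`), every `p`, every `t ≥ 1`, at `3 ∣ N`.

HONEST FRAMING: elementary (Manin symbols + Dirichlet); neither law is proved; C3, Manin's conjecture and BSD are NOT proved.
No definitions, no named facts, no sorry.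
-/

set_option linter.dupNamespace false
set_option autoImplicit false

noncomputable section

open scoped MatrixGroups ModularForm ComplexConjugate

open CongruenceSubgroup Complex Literature.NumberTheory.EllipticCurves
  Literature.NumberTheory.EllipticCurves.ModularForms
  Summit.BirchSwinnertonDyer.Rank1Residual.ManinAdditive.Gamma1Lattice
  Summit.BirchSwinnertonDyer.Rank1Residual.ManinAdditive.KatoCurve

namespace Summit.BirchSwinnertonDyer.BirchSwinnertonDyer.Theorems.ManinLocalTwoThree

variable {N : ℕ} [NeZero N] (f : CuspForm (Gamma0 N) 2)

/-- **The sign move without conjugation**: for ANY `f` and `ℓ = −ℓ' + NKc` (`ℓ, ℓ' ≠ 0`), `{∞, c/ℓ}_f = {∞, (−c)/ℓ'}_f`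
(`c/ℓ = r/(NKr + 1)` with `r = −c/ℓ'`, and the lower unipotent has zero period). [cite: Manin1972, Prop. 1.4 / Thm. 1.6] -/
theorem modularSymbol_div_eq_neg_div_of_neg_add {ℓ ℓ' : ℤ} (hℓ : ℓ ≠ 0) (hℓ' : ℓ' ≠ 0) {c K : ℤ}
    (h : ℓ = -ℓ' + N * K * c) :
    modularSymbol f ((c : ℚ) / ℓ) = modularSymbol f (((-c : ℤ) : ℚ) / ℓ') := by
  have hℓQ : (ℓ : ℚ) ≠ 0 := by exact_mod_cast hℓ
  have hℓ'Q : (ℓ' : ℚ) ≠ 0 := by exact_mod_cast hℓ'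
  have hℓeq : (ℓ : ℚ) = -ℓ' + N * K * c := by exact_mod_cast h
  have e : (N : ℚ) * K * (-((c : ℚ) / ℓ')) + 1 = -(ℓ : ℚ) / ℓ' := by
    rw [hℓeq]; field_simp; ring
  have hden : (N : ℚ) * K * (-((c : ℚ) / ℓ')) + 1 ≠ 0 := by
    rw [e]
    exact div_ne_zero (neg_ne_zero.mpr hℓQ) hℓ'Q
  have hq : -((c : ℚ) / ℓ') / ((N : ℚ) * K * (-((c : ℚ) / ℓ')) + 1) = (c : ℚ) / ℓ := by
    rw [e]
    field_simp
  rw [← hq, modularSymbol_div_lowerUnipotent f _ K hden]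
  push_cast
  rw [neg_div]

/-- **At `3 ∣ N` every ratio-`t` degeneracy loop is a prime-class loop** (`t ≥ 1`): a loop at a prime `ℓ ≡ 1 (mod 3)` equals the
loop at `(ℓ', ℓ' − b mod ℓ')` for a prime `ℓ' ≡ −ℓ (mod tNb)` (Dirichlet), `ℓ' ≡ 2 (mod 3)`. -/
theorem degeneracyLoops_subset_degeneracyLoopsClassTwo (h3 : 3 ∣ N) {t : ℕ} (ht : 0 < t) :
    degeneracyLoops f t ⊆ degeneracyLoopsClassTwo f t := by
  rintro z ⟨ℓ, b, hℓ, hℓt, hℓb, rfl⟩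
  have hℓ3 : ¬ 3 ∣ ℓ := by
    intro h
    have : ℓ = 3 := ((Nat.prime_dvd_prime_iff_eq Nat.prime_three hℓ).mp h).symm
    exact hℓt (this ▸ dvd_mul_of_dvd_right h3 t)
  by_cases hmod : ℓ % 3 = 2
  · exact ⟨ℓ, b, hℓ, hmod, hℓt, hℓb, rfl⟩
  · have hmod1 : ℓ % 3 = 1 := by omega
    have hb0 : b ≠ 0 := by rintro rfl; exact hℓb (dvd_zero ℓ)
    set q : ℕ := t * N * b with hq
    have hq0 : q ≠ 0 := mul_ne_zero (mul_ne_zero ht.ne' (NeZero.ne N)) hb0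
    have hℓq : ¬ ℓ ∣ q := by
      intro h
      rcases (Nat.Prime.dvd_mul hℓ).mp h with h1 | h1
      · exact hℓt h1
      · exact hℓb h1
    have hcop : IsCoprime (-(ℓ : ℤ)) (q : ℤ) :=
      (Nat.isCoprime_iff_coprime.mpr ((Nat.Prime.coprime_iff_not_dvd hℓ).mpr hℓq)).neg_left
    obtain ⟨ℓ', -, hℓ'p, hℓ'mod⟩ := Nat.forall_exists_prime_gt_and_zmodEq 0 hq0 hcop
    obtain ⟨k, hk⟩ : ∃ k : ℤ, (ℓ : ℤ) = -ℓ' + N * (t * k * b) := by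
      obtain ⟨c, hc⟩ := Int.modEq_iff_dvd.mp hℓ'mod.symm
      refine ⟨c, ?_⟩
      rw [hq] at hc; push_cast at hc; linear_combination hc
    have hℓ'q : ¬ ℓ' ∣ q := by
      intro hd
      have hdZ : (ℓ' : ℤ) ∣ (q : ℤ) := Int.natCast_dvd_natCast.mpr hd
      have h1 : (ℓ' : ℤ) ∣ (ℓ : ℤ) := by
        have e : (ℓ : ℤ) = -ℓ' + k * (q : ℤ) := by rw [hk, hq]; push_cast; ring
        rw [e]
        exact dvd_add (dvd_neg.mpr dvd_rfl) (hdZ.mul_left k)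
      have h2 : ℓ' ∣ ℓ := Int.natCast_dvd_natCast.mp h1
      have : ℓ' = ℓ := (Nat.prime_dvd_prime_iff_eq hℓ'p hℓ).mp h2
      exact hℓq (this ▸ hd)
    have hℓ't : ¬ ℓ' ∣ t * N := fun h ↦ hℓ'q (h.mul_right b)
    have hℓ'b : ¬ ℓ' ∣ b := fun h ↦ hℓ'q (h.mul_left _)
    have hℓ'3 : ℓ' % 3 = 2 := by
      have h3q : (3 : ℤ) ∣ (q : ℤ) := by
        rw [hq]; push_cast; exact (dvd_mul_of_dvd_right (by exact_mod_cast h3) _).mul_right _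
      have hm3 : (ℓ' : ℤ) ≡ -ℓ [ZMOD 3] := hℓ'mod.of_dvd h3q
      have e1 : ((ℓ' % 3 : ℕ) : ℤ) = ((-(ℓ : ℤ)) % 3) := by push_cast; exact hm3
      omega
    -- the new numerator `b'' = ℓ' − (b mod ℓ')`
    obtain ⟨r, qb, hrlt, hbdecomp⟩ : ∃ r qb : ℕ, r < ℓ' ∧ b = r + ℓ' * qb :=
      ⟨b % ℓ', b / ℓ', Nat.mod_lt b hℓ'p.pos, (Nat.mod_add_div b ℓ').symm⟩
    have hr0 : 0 < r := Nat.pos_of_ne_zero fun h0 ↦ hℓ'b ⟨qb, by rw [hbdecomp, h0, zero_add]⟩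
    set b'' : ℕ := ℓ' - r with hb''
    have hb''pos : 0 < b'' := by omega
    have hb''lt : b'' < ℓ' := by omega
    have hℓ'b'' : ¬ ℓ' ∣ b'' := fun h ↦ absurd (Nat.le_of_dvd hb''pos h) (not_le.mpr hb''lt)
    refine ⟨ℓ', b'', hℓ'p, hℓ'3, hℓ't, hℓ'b'', ?_⟩
    -- the two cusps move together
    have hℓ0 : (ℓ : ℤ) ≠ 0 := by exact_mod_cast hℓ.ne_zero
    have hℓ'0 : (ℓ' : ℤ) ≠ 0 := by exact_mod_cast hℓ'p.ne_zero
    have hℓ'Q : (ℓ' : ℚ) ≠ 0 := by exact_mod_cast hℓ'p.ne_zero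
    have hdecomp : (b : ℚ) = (r : ℚ) + (ℓ' : ℚ) * (qb : ℚ) := by exact_mod_cast hbdecomp
    have hb''Q : (b'' : ℚ) = (ℓ' : ℚ) - (r : ℚ) := by rw [hb'', Nat.cast_sub hrlt.le]
    have e1 : modularSymbol f ((b : ℚ) / ℓ) = modularSymbol f ((b'' : ℚ) / ℓ') := by
      have := modularSymbol_div_eq_neg_div_of_neg_add f hℓ0 hℓ'0 (c := b) (K := t * k) (by rw [hk]; ring)
      push_cast at this
      rw [this]
      have e : (-(b : ℚ)) / (ℓ' : ℚ) = (b'' : ℚ) / ℓ' + (((-1 : ℤ) - (qb : ℤ) : ℤ) : ℚ) := by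
        rw [hb''Q, hdecomp]; push_cast; field_simp; ring
      rw [e, modularSymbol_add_intCast_holds f]
    have e2 : modularSymbol f (((t * b : ℕ) : ℚ) / ℓ) = modularSymbol f (((t * b'' : ℕ) : ℚ) / ℓ') := by
      have := modularSymbol_div_eq_neg_div_of_neg_add f hℓ0 hℓ'0 (c := (t * b : ℕ)) (K := k)
        (by rw [hk]; push_cast; ring)
      push_cast at this ⊢
      rw [this]
      have e : (-((t : ℚ) * (b : ℚ))) / (ℓ' : ℚ) =
          (t : ℚ) * (b'' : ℚ) / ℓ' + (((-(t : ℤ)) - (t : ℤ) * (qb : ℤ) : ℤ) : ℚ) := by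
        rw [hb''Q, hdecomp]; push_cast; field_simp; ring
      rw [e, modularSymbol_add_intCast_holds f]
    rw [e1, e2]

/-- At `3 ∣ N` the closures of the two loop sets coincide. -/
theorem closure_degeneracyLoops_eq_closure_degeneracyLoopsClassTwo (h3 : 3 ∣ N) {t : ℕ} (ht : 0 < t) :
    AddSubgroup.closure (degeneracyLoops f t) = AddSubgroup.closure (degeneracyLoopsClassTwo f t) :=
  le_antisymm (AddSubgroup.closure_mono (degeneracyLoops_subset_degeneracyLoopsClassTwo f h3 ht))
    (AddSubgroup.closure_mono (degeneracyLoopsClassTwo_subset_degeneracyLoops f t))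

/-- **E-es-68₉ ⟹ E-es-91** (the converse of the typer's `degeneracyLoopLawNine_of_classLawNine`). -/
theorem degeneracyClassLoopLawNine_of_lawNine (h : DegeneracyLoopLawNine) : DegeneracyClassLoopLawNine := by
  intro N _ h9 f
  rw [← closure_degeneracyLoops_eq_closure_degeneracyLoopsClassTwo f (dvd_trans (by norm_num) h9) (by norm_num)]
  exact h h9 f

/-- **E-es-91 ⟺ E-es-68₉**: the prime-class and the plain ratio-`9` degeneracy-loop laws are the same row. -/
theorem degeneracyClassLoopLawNine_iff : DegeneracyClassLoopLawNine ↔ DegeneracyLoopLawNine :=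
  ⟨degeneracyLoopLawNine_of_classLawNine, degeneracyClassLoopLawNine_of_lawNine⟩

/-- **The class plus-index hypothesis of THEOREM U♮ from the plain one** (`3 ∣ N`, `t ≥ 1`, any `p`). -/
theorem degeneracyClassPlusIndexPrimeTo_of_degeneracyPlusIndexPrimeTo (h3 : 3 ∣ N) {p t : ℕ} (ht : 0 < t)
    (hd : DegeneracyPlusIndexPrimeTo p t f) : DegeneracyClassPlusIndexPrimeTo f p t := by
  intro x hx
  obtain ⟨y, hy, k, hk, hxy⟩ := hd x hx
  exact ⟨y, by rw [← closure_degeneracyLoops_eq_closure_degeneracyLoopsClassTwo f h3 ht]; exact hy, k, hk, hxy⟩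

omit [NeZero N] in
/-- And conversely (any level): the class hypothesis implies the plain one. -/
theorem degeneracyPlusIndexPrimeTo_of_degeneracyClassPlusIndexPrimeTo {p t : ℕ}
    (hd : DegeneracyClassPlusIndexPrimeTo f p t) : DegeneracyPlusIndexPrimeTo p t f := by
  intro x hx
  obtain ⟨y, hy, k, hk, hxy⟩ := hd x hx
  exact ⟨y, AddSubgroup.closure_mono (degeneracyLoopsClassTwo_subset_degeneracyLoops f t) hy, k, hk, hxy⟩

end Summit.BirchSwinnertonDyer.BirchSwinnertonDyer.Theorems.ManinLocalTwoThree

end
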